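import Mathlib
import HarnessLib
import Literature.Barriers.HubbardSuperconductivity.WeakCouplingCeiling

/-!
# Crux K2 `PoloidalWindowRigidity` (stmt-NavierStokesRegularity-19708), line `z_shock` — NEGATIVE KERNEL BRICK 2 for the class-free
# slice Liouville `hGN`: the HUMP two-wave map is a local diffeomorphism with a UNIFORM Jacobian floor (`τ_r ≥ c > 0`)

`--supports stmt-NavierStokesRegularity-19708 --as helper` (leafhand-ns-poloidalwindowdoor-3 g34, cell decomp-ns, 2026-09-01).
Class-free, def-free, Mathlib only.  **No stub and no summit is closed by this file; Navier–Stokes regularity is NOT proved here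
(rung 0).**  Companion of `…ZShockHodographDarboux` (p842123) and of the evidence memo `HGN-COUNTEREXAMPLE-leafhand3-g34.md` on the
crux item, whose §3 (the only non-routine step of the paper refutation of `hGN`) is kernel-checked here.

The Darboux–hodograph pair of `…ZShockHodographDarboux` with the HUMP speed `k = (1 − ρ tanh ρ)²` (`α = 0`, `β = −1`) and the data
`f = g = artanh(·/m)`, `F(t) = (m/2)[(1+t/m) log(1+t/m) + (1−t/m) log(1−t/m)]` (`F' = f`) is
`τ = [f(r) − f(s) − tanh(ρ)(F(r)+F(s))]/ψ(ρ)`, `ρ = (r−s)/2`, `ψ = 1 − ρ tanh ρ`.  Its `r`-derivative (the value recorded by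
`…HodographDarboux.hodograph_r` with `T₁ = 1 − tanh²ρ`, `ψ₁ = −(tanh ρ + ρ(1 − tanh²ρ))`) has the closed form

  `2ψ² τ_r = 2ψ(ρ) f'(r) + c₁(ρ) f(r) − c₂(ρ) f(s) − F(r) − F(s)`,  `c₁ = ρ − t + ρt²`, `c₂ = ρ + t − ρt²`, `t = tanh ρ`

(`two_psi_sq_mul`), and THIS FILE PROVES the uniform floor `2ψ²τ_r ≥ (1 − m²)²/m − 2m > 0` on the open square `|r|, |s| < m`,
`0 < m ≤ 1/2` (`hump_core`, `hump_floor`, `hump_floor_pos`; hence `τ_r > 0` for the recorded derivative value, `hump_tau_r_pos`)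
by the three-region sign analysis of the memo (`s ≤ 0 ≤ r`: both cross terms
non-negative; `0 < s ≤ r`: `c₁f(r) − c₂f(s) ≥ −2tψ f(r)` and `t f(r) ≤ (m x/2)·x(2−x)/(2(1−x))`; `s ≤ r < 0`: the cross terms have
positive sum; `r < s` by the symmetry `(r,s) ↦ (−r,−s)`).  With `τ(s,r) = −τ(r,s)` this gives `τ_r ≥ c > 0 ≥ −c ≥ τ_s`, i.e. the
Jacobian `2ψ²τ_rτ_s` of `(r,s) ↦ (τ, ξ)` never vanishes and the inverse — the eternal bounded analytic two-wave solution of the hump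
p-system that inhabits `hGN` after the oblique embedding — has gradient bounded by `1/(ψ(m)²c)`.  Elementary inputs proved here (`|tanh x| ≤ |x|` is
imported from the tree, `Literature.Barriers.HubbardSuperconductivity.abs_tanh_le_abs_self`): `artanh x ≤ x(2−x)/(2(1−x))` on `[0,1)`, `(1+x)log(1+x) + (1−x)log(1−x) ≤ 2x²` on `(−1,1)`, `artanh(−x) = −artanh x`.
[folklore]
-/

noncomputable section

namespace Summit.NavierStokesRegularity.NavierStokesRegularity.Theorems.PoloidalWindowDoorPoloidalWindowRigidityZShockHodographHump

-- the problem directory repeats the summit name (`NavierStokesRegularity/NavierStokesRegularity`)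
set_option linter.dupNamespace false

open Real Set

/-- `artanh` is odd. [folklore] -/
theorem artanh_neg_eq (x : ℝ) : Real.artanh (-x) = -Real.artanh x := by
  unfold Real.artanh
  rw [← Real.log_inv]
  congr 1
  rw [← Real.sqrt_inv, inv_div]
  ring_nf

/-- `artanh x ≤ x(2 − x)/(2(1 − x))` for `0 ≤ x < 1` (from `log(1+x) ≤ x` and `log(1−x) ≥ −x/(1−x)`). [folklore] -/
theorem artanh_le_bound {x : ℝ} (h0 : 0 ≤ x) (h1 : x < 1) :
    Real.artanh x ≤ x * (2 - x) / (2 * (1 - x)) := by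
  rw [Real.artanh_eq_half_log ⟨by linarith, h1.le⟩]
  have hpos1 : 0 < 1 + x := by linarith
  have hpos2 : 0 < 1 - x := by linarith
  rw [Real.log_div hpos1.ne' hpos2.ne']
  have hA : Real.log (1 + x) ≤ x := by
    have := Real.log_le_sub_one_of_pos hpos1; linarith
  have hB : -(x / (1 - x)) ≤ Real.log (1 - x) := by
    have := Real.one_sub_inv_le_log_of_pos hpos2
    have : 1 - (1 - x)⁻¹ = -(x / (1 - x)) := by field_simp; ring
    linarith
  have : 1 / 2 * (Real.log (1 + x) - Real.log (1 - x)) ≤ 1 / 2 * (x + x / (1 - x)) := by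
    apply mul_le_mul_of_nonneg_left _ (by norm_num); linarith
  refine this.trans (le_of_eq ?_)
  field_simp
  ring

/-- The entropy-type bound `(1+x)log(1+x) + (1−x)log(1−x) ≤ 2x²` on `(−1, 1)` (from `log y ≤ y − 1`). [folklore] -/
theorem entropy_le_two_sq {x : ℝ} (h0 : -1 < x) (h1 : x < 1) :
    (1 + x) * Real.log (1 + x) + (1 - x) * Real.log (1 - x) ≤ 2 * x ^ 2 := by
  have hpos1 : 0 < 1 + x := by linarith
  have hpos2 : 0 < 1 - x := by linarith
  have hA : Real.log (1 + x) ≤ x := by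
    have := Real.log_le_sub_one_of_pos hpos1; linarith
  have hB : Real.log (1 - x) ≤ -x := by
    have := Real.log_le_sub_one_of_pos hpos2; linarith
  have h1' : (1 + x) * Real.log (1 + x) ≤ (1 + x) * x := mul_le_mul_of_nonneg_left hA hpos1.le
  have h2' : (1 - x) * Real.log (1 - x) ≤ (1 - x) * (-x) := mul_le_mul_of_nonneg_left hB hpos2.le
  nlinarith

/-- ★ **Closed form of `2ψ²τ_r` for the hump pair** (`ψ = 1 − ρt`, `T₁ = 1 − t²`, `ψ₁ = −(t + ρ(1−t²))`, `t = tanh ρ`; the value of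
`τ_r` is the one recorded by `…HodographDarboux.hodograph_r`): pure algebra, valid for any numbers `fr = f(r)`, `fs = f(s)`,
`f₁ = f'(r)`, `Fr = F(r)`, `Fs = F(s)` and any `t`, `ρ` with `1 − ρt ≠ 0`. [folklore] -/
theorem two_psi_sq_mul (t ρ fr fs f₁ Fr Fs : ℝ) (hψ : 1 - ρ * t ≠ 0) :
    2 * (1 - ρ * t) ^ 2 *
        (((f₁ - ((1 - t ^ 2) * (1 / 2) * (Fr + Fs) + t * fr)) * (1 - ρ * t) -
            (fr - fs - t * (Fr + Fs)) * (-(t + ρ * (1 - t ^ 2)) * (1 / 2))) / (1 - ρ * t) ^ 2) =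
      2 * (1 - ρ * t) * f₁ + (ρ - t + ρ * t ^ 2) * fr - (ρ + t - ρ * t ^ 2) * fs - (Fr + Fs) := by
  field_simp
  ring

/-- `tanh ρ ∈ [0, ρ]` for `ρ ≥ 0`. [folklore] -/
theorem tanh_nonneg_le {ρ : ℝ} (hρ : 0 ≤ ρ) : 0 ≤ Real.tanh ρ ∧ Real.tanh ρ ≤ ρ := by
  have h0 : 0 ≤ Real.tanh ρ := by
    rw [Real.tanh_eq_sinh_div_cosh]
    exact div_nonneg (Real.sinh_nonneg_iff.mpr hρ) (Real.cosh_pos ρ).le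
  refine ⟨h0, ?_⟩
  have h := Literature.Barriers.HubbardSuperconductivity.abs_tanh_le_abs_self ρ
  rw [abs_of_nonneg h0, abs_of_nonneg hρ] at h
  exact h

/-- Arithmetic: `(1 − m²)²/m ≤ 2ψ f₁` when `ψ ≥ 1 − m²`, `f₁ ≥ 1/m`, `m² ≤ 1/4`. [folklore] -/
theorem base_bound (m ψ f₁ : ℝ) (hm : 0 < m) (hm2 : m ^ 2 ≤ 1 / 4) (hψ : 1 - m ^ 2 ≤ ψ) (hf : 1 / m ≤ f₁) :
    (1 - m ^ 2) ^ 2 / m ≤ 2 * ψ * f₁ := by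
  have h1 : (1 - m ^ 2) ^ 2 / m ≤ 2 * (1 - m ^ 2) * (1 / m) := by
    rw [div_le_iff₀ hm]
    have : 2 * (1 - m ^ 2) * (1 / m) * m = 2 * (1 - m ^ 2) := by field_simp
    rw [this]; nlinarith
  have hA : 0 ≤ 2 * (1 - m ^ 2) := by nlinarith
  have hf0 : 0 ≤ f₁ := le_trans (by positivity) hf
  calc (1 - m ^ 2) ^ 2 / m ≤ 2 * (1 - m ^ 2) * (1 / m) := h1
    _ ≤ 2 * (1 - m ^ 2) * f₁ := mul_le_mul_of_nonneg_left hf hA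
    _ ≤ 2 * ψ * f₁ := by
        apply mul_le_mul_of_nonneg_right _ hf0
        linarith

/-- Arithmetic: `(1 − m²)²/m ≤ 2ψ D` when `ψ ≥ 1 − m²`, `D ≥ (1 − m²)/(2m)`, `m² ≤ 1/4`. [folklore] -/
theorem assemble_bound (m ψ D : ℝ) (hm : 0 < m) (hm2 : m ^ 2 ≤ 1 / 4) (hψ : 1 - m ^ 2 ≤ ψ)
    (hD : (1 - m ^ 2) / (2 * m) ≤ D) : (1 - m ^ 2) ^ 2 / m ≤ 2 * ψ * D := by
  have hD0 : 0 ≤ D := le_trans (div_nonneg (by nlinarith) (by positivity)) hD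
  have step1 : (1 - m ^ 2) ^ 2 / m = 2 * (1 - m ^ 2) * ((1 - m ^ 2) / (2 * m)) := by
    field_simp
  have hA : 0 ≤ 2 * (1 - m ^ 2) := by nlinarith
  rw [step1]
  calc 2 * (1 - m ^ 2) * ((1 - m ^ 2) / (2 * m)) ≤ 2 * (1 - m ^ 2) * D := mul_le_mul_of_nonneg_left hD hA
    _ ≤ 2 * ψ * D := by
        apply mul_le_mul_of_nonneg_right _ hD0
        linarith

/-- The fraction bound of region (ii): `(1 − m²)/(2m) ≤ f₁ − (m x/2)·x(2−x)/(2(1−x))` with `f₁ = (1/m)/(1 − x²)`,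
`0 < x < 1`, `m² ≤ 1/4`. [folklore] -/
theorem frac_bound (m x : ℝ) (hm : 0 < m) (hm2 : m ^ 2 ≤ 1 / 4) (hx0 : 0 < x) (hx1 : x < 1) :
    (1 - m ^ 2) / (2 * m) ≤ 1 / m / (1 - x ^ 2) - m * x / 2 * (x * (2 - x) / (2 * (1 - x))) := by
  have h1x : 0 < 1 - x := by linarith
  have h1x' : 0 < 1 + x := by linarith
  have hx2ne : 1 - x ^ 2 ≠ 0 := by nlinarith
  have h1xne : 1 - x ≠ 0 := h1x.ne'
  have h1xne' : 1 + x ≠ 0 := h1x'.ne'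
  have hmne : m ≠ 0 := hm.ne'
  have hid : 1 / m / (1 - x ^ 2) - m * x / 2 * (x * (2 - x) / (2 * (1 - x))) =
      (4 - m ^ 2 * x ^ 2 * (2 - x) * (1 + x)) / (4 * m * ((1 - x) * (1 + x))) := by
    field_simp
    ring
  rw [hid, div_le_div_iff₀ (by positivity) (by positivity)]
  have hx2 : x ^ 2 ≤ 1 := by nlinarith
  have hq : x ^ 2 * (2 - x) * (1 + x) ≤ 3 := by nlinarith [mul_nonneg hx0.le h1x.le]
  have hmq : m ^ 2 * (x ^ 2 * (2 - x) * (1 + x)) ≤ 1 / 4 * 3 :=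
    mul_le_mul hm2 hq (by nlinarith [mul_nonneg hx0.le h1x.le]) (by norm_num)
  nlinarith [mul_pos hm h1x, mul_pos (mul_pos hm h1x) h1x', sq_nonneg x, hmq]

set_option maxHeartbeats 400000 in
/-- ★ **Core of the floor (case `s ≤ r`, without the `F`-terms):**
`(1 − m²)²/m ≤ 2ψ f'(r) + c₁ artanh(r/m) − c₂ artanh(s/m)` for `0 < m ≤ 1/2`, `|r|, |s| < m`, `s ≤ r`
(three regions `s ≤ 0 ≤ r` / `0 < s` / `r < 0`; memo §3). [folklore] -/
theorem hump_core (m r s : ℝ) (hm : 0 < m) (hm' : m ≤ 1 / 2) (hr : |r| < m) (hs : |s| < m) (hle : s ≤ r) :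
    (1 - m ^ 2) ^ 2 / m ≤
      2 * (1 - (r - s) / 2 * Real.tanh ((r - s) / 2)) * (1 / m / (1 - (r / m) ^ 2)) +
        ((r - s) / 2 - Real.tanh ((r - s) / 2) + (r - s) / 2 * Real.tanh ((r - s) / 2) ^ 2) * Real.artanh (r / m) -
        ((r - s) / 2 + Real.tanh ((r - s) / 2) - (r - s) / 2 * Real.tanh ((r - s) / 2) ^ 2) * Real.artanh (s / m) := by
  set ρ : ℝ := (r - s) / 2 with hρdef
  set t : ℝ := Real.tanh ρ with htdef
  set x : ℝ := r / m with hxdef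
  set y : ℝ := s / m with hydef
  have hrabs := abs_lt.mp hr
  have hsabs := abs_lt.mp hs
  have hx1 : x < 1 := by rw [hxdef, div_lt_one hm]; linarith
  have hx0 : -1 < x := by rw [hxdef, lt_div_iff₀ hm]; linarith
  have hy0 : -1 < y := by rw [hydef, lt_div_iff₀ hm]; linarith
  have hyx : y ≤ x := by rw [hxdef, hydef]; exact div_le_div_of_nonneg_right hle hm.le
  have hρ0 : 0 ≤ ρ := by rw [hρdef]; linarith
  have hρm : ρ < m := by rw [hρdef]; linarith
  obtain ⟨ht0, htρ⟩ := tanh_nonneg_le hρ0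
  have hm2 : m ^ 2 ≤ 1 / 4 := by nlinarith
  -- ψ ≥ 1 - m²
  have hψ : 1 - m ^ 2 ≤ 1 - ρ * t := by nlinarith [mul_nonneg hρ0 ht0]
  have hψpos : 0 < 1 - ρ * t := by nlinarith
  -- f₁ ≥ 1/m
  have hxsq : 0 < 1 - x ^ 2 := by nlinarith
  have hf1 : 1 / m ≤ 1 / m / (1 - x ^ 2) := by
    rw [le_div_iff₀ hxsq]
    have : 0 < 1 / m := by positivity
    nlinarith [sq_nonneg x]
  -- c₁, c₂ ≥ 0
  have hc1 : 0 ≤ ρ - t + ρ * t ^ 2 := by nlinarith [mul_nonneg hρ0 (sq_nonneg t)]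
  have hc2 : 0 ≤ ρ + t - ρ * t ^ 2 := by
    have ht1 : t < 1 := Real.tanh_lt_one ρ
    nlinarith [mul_nonneg hρ0 ht0]
  have hbase : (1 - m ^ 2) ^ 2 / m ≤ 2 * (1 - ρ * t) * (1 / m / (1 - x ^ 2)) :=
    base_bound m _ _ hm hm2 hψ hf1
  have hid : (ρ - t + ρ * t ^ 2) * Real.artanh x - (ρ + t - ρ * t ^ 2) * Real.artanh x =
      -(2 * t * (1 - ρ * t) * Real.artanh x) := by ring
  rcases le_or_gt 0 r with hr0 | hr0
  · rcases le_or_gt s 0 with hs0 | hs0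
    · -- (i) s ≤ 0 ≤ r
      have hax : 0 ≤ Real.artanh x := Real.artanh_nonneg (by rw [hxdef]; positivity)
      have hay : Real.artanh y ≤ 0 :=
        Real.artanh_nonpos (by rw [hydef]; exact div_nonpos_of_nonpos_of_nonneg hs0 hm.le)
      have p1 := mul_nonneg hc1 hax
      have p2 : (ρ + t - ρ * t ^ 2) * Real.artanh y ≤ 0 := mul_nonpos_of_nonneg_of_nonpos hc2 hay
      linarith
    · -- (ii) 0 < s ≤ r
      have hxpos : 0 < x := by rw [hxdef]; exact div_pos (by linarith) hm
      have hax : 0 ≤ Real.artanh x := Real.artanh_nonneg hxpos.le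
      have hayx : Real.artanh y ≤ Real.artanh x := Real.artanh_le_artanh hy0 hx1 hyx
      have h1 : (ρ + t - ρ * t ^ 2) * Real.artanh y ≤ (ρ + t - ρ * t ^ 2) * Real.artanh x :=
        mul_le_mul_of_nonneg_left hayx hc2
      have hmx : m * x = r := by rw [hxdef]; field_simp
      have htx : t ≤ m * x / 2 := by
        have : ρ ≤ m * x / 2 := by rw [hmx, hρdef]; linarith
        linarith
      have haxb : Real.artanh x ≤ x * (2 - x) / (2 * (1 - x)) := artanh_le_bound hxpos.le hx1
      have htax : t * Real.artanh x ≤ m * x / 2 * (x * (2 - x) / (2 * (1 - x))) :=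
        mul_le_mul htx haxb hax (by positivity)
      have hfrac := frac_bound m x hm hm2 hxpos hx1
      have hkey : (1 - m ^ 2) / (2 * m) ≤ 1 / m / (1 - x ^ 2) - t * Real.artanh x := by linarith
      have hfin := assemble_bound m (1 - ρ * t) _ hm hm2 hψ hkey
      have hexp : 2 * (1 - ρ * t) * (1 / m / (1 - x ^ 2) - t * Real.artanh x) =
          2 * (1 - ρ * t) * (1 / m / (1 - x ^ 2)) - 2 * t * (1 - ρ * t) * Real.artanh x := by ring
      linarith
  · -- (iii) s ≤ r < 0
    have hxneg : x < 0 := by rw [hxdef]; exact div_neg_of_neg_of_pos hr0 hm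
    have hax : Real.artanh x < 0 := Real.artanh_neg ⟨hx0, hxneg⟩
    have hayx : Real.artanh y ≤ Real.artanh x := Real.artanh_le_artanh hy0 hx1 hyx
    have h1 : (ρ + t - ρ * t ^ 2) * Real.artanh y ≤ (ρ + t - ρ * t ^ 2) * Real.artanh x :=
      mul_le_mul_of_nonneg_left hayx hc2
    have h2 : 0 ≤ -(2 * t * (1 - ρ * t) * Real.artanh x) := by
      have : 0 ≤ 2 * t * (1 - ρ * t) := by nlinarith [mul_nonneg ht0 hψpos.le]
      nlinarith
    linarith

/-- The primitive `F(t) = (m/2)[(1+t/m)log(1+t/m) + (1−t/m)log(1−t/m)]` of `artanh(·/m)` is `≤ m` on `|t| < m`. [folklore] -/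
theorem prim_le (m r : ℝ) (hm : 0 < m) (hr : |r| < m) :
    m / 2 * ((1 + r / m) * Real.log (1 + r / m) + (1 - r / m) * Real.log (1 - r / m)) ≤ m := by
  have hrabs := abs_lt.mp hr
  have hx1 : r / m < 1 := by rw [div_lt_one hm]; linarith
  have hx0 : -1 < r / m := by rw [lt_div_iff₀ hm]; linarith
  have h := entropy_le_two_sq hx0 hx1
  have hx2 : (r / m) ^ 2 ≤ 1 := by nlinarith
  nlinarith

/-- ★ **THE FLOOR.**  For `0 < m ≤ 1/2` and `|r|, |s| < m`:
`(1 − m²)²/m − 2m ≤ 2ψ f'(r) + c₁ f(r) − c₂ f(s) − F(r) − F(s) = 2ψ²τ_r` (all `r, s`; the case `r < s` by the symmetry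
`(r, s) ↦ (−r, −s)`, under which the right-hand side is invariant). [folklore] -/
theorem hump_floor (m r s : ℝ) (hm : 0 < m) (hm' : m ≤ 1 / 2) (hr : |r| < m) (hs : |s| < m) :
    (1 - m ^ 2) ^ 2 / m - 2 * m ≤
      2 * (1 - (r - s) / 2 * Real.tanh ((r - s) / 2)) * (1 / m / (1 - (r / m) ^ 2)) +
        ((r - s) / 2 - Real.tanh ((r - s) / 2) + (r - s) / 2 * Real.tanh ((r - s) / 2) ^ 2) * Real.artanh (r / m) -
        ((r - s) / 2 + Real.tanh ((r - s) / 2) - (r - s) / 2 * Real.tanh ((r - s) / 2) ^ 2) * Real.artanh (s / m) -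
        (m / 2 * ((1 + r / m) * Real.log (1 + r / m) + (1 - r / m) * Real.log (1 - r / m)) +
          m / 2 * ((1 + s / m) * Real.log (1 + s / m) + (1 - s / m) * Real.log (1 - s / m))) := by
  have hFr := prim_le m r hm hr
  have hFs := prim_le m s hm hs
  have hcore : (1 - m ^ 2) ^ 2 / m ≤
      2 * (1 - (r - s) / 2 * Real.tanh ((r - s) / 2)) * (1 / m / (1 - (r / m) ^ 2)) +
        ((r - s) / 2 - Real.tanh ((r - s) / 2) + (r - s) / 2 * Real.tanh ((r - s) / 2) ^ 2) * Real.artanh (r / m) -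
        ((r - s) / 2 + Real.tanh ((r - s) / 2) - (r - s) / 2 * Real.tanh ((r - s) / 2) ^ 2) * Real.artanh (s / m) := by
    rcases le_or_gt s r with hle | hlt
    · exact hump_core m r s hm hm' hr hs hle
    · have h := hump_core m (-r) (-s) hm hm' (by simpa using hr) (by simpa using hs) (by linarith)
      have e1 : (-r - -s) / 2 = -((r - s) / 2) := by ring
      rw [e1, Real.tanh_neg, neg_div, neg_div, artanh_neg_eq, artanh_neg_eq, neg_sq] at h
      convert h using 1
      ring
  linarith

/-- The floor is positive: `0 < (1 − m²)²/m − 2m` for `0 < m ≤ 1/2`. [folklore] -/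
theorem hump_floor_pos (m : ℝ) (hm : 0 < m) (hm' : m ≤ 1 / 2) : 0 < (1 - m ^ 2) ^ 2 / m - 2 * m := by
  rw [sub_pos, lt_div_iff₀ hm]
  have hm2 : m ^ 2 ≤ 1 / 4 := by nlinarith
  nlinarith

/-- ★ **Consequently `τ_r > 0` with the uniform floor**: the `r`-derivative value of the hump Darboux map (the `Z₁` of
`…HodographDarboux.hodograph_r` with `T₁ = 1 − tanh²`, `ψ₁ = −(tanh ρ + ρ(1 − tanh²ρ))`, data `f = artanh(·/m)`,
`f' = (1/m)/(1 − (r/m)²)`, `F` as above) satisfies `2(1 − ρ tanh ρ)² τ_r ≥ (1 − m²)²/m − 2m > 0` on the whole open square; by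
`τ(s,r) = −τ(r,s)` the same floor bounds `−τ_s`, so the Jacobian `2ψ²τ_rτ_s` never vanishes (memo §3). [folklore] -/
theorem hump_tau_r_pos (m r s : ℝ) (hm : 0 < m) (hm' : m ≤ 1 / 2) (hr : |r| < m) (hs : |s| < m) :
    0 < ((1 / m / (1 - (r / m) ^ 2) -
            ((1 - Real.tanh ((r - s) / 2) ^ 2) * (1 / 2) *
                (m / 2 * ((1 + r / m) * Real.log (1 + r / m) + (1 - r / m) * Real.log (1 - r / m)) +
                  m / 2 * ((1 + s / m) * Real.log (1 + s / m) + (1 - s / m) * Real.log (1 - s / m))) +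
              Real.tanh ((r - s) / 2) * Real.artanh (r / m))) *
          (1 - (r - s) / 2 * Real.tanh ((r - s) / 2)) -
        (Real.artanh (r / m) - Real.artanh (s / m) -
            Real.tanh ((r - s) / 2) *
              (m / 2 * ((1 + r / m) * Real.log (1 + r / m) + (1 - r / m) * Real.log (1 - r / m)) +
                m / 2 * ((1 + s / m) * Real.log (1 + s / m) + (1 - s / m) * Real.log (1 - s / m)))) *
          (-(Real.tanh ((r - s) / 2) + (r - s) / 2 * (1 - Real.tanh ((r - s) / 2) ^ 2)) * (1 / 2))) /
      (1 - (r - s) / 2 * Real.tanh ((r - s) / 2)) ^ 2 := by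
  have hfl := hump_floor m r s hm hm' hr hs
  have hpos := hump_floor_pos m hm hm'
  set ρ : ℝ := (r - s) / 2 with hρdef
  set t : ℝ := Real.tanh ρ with htdef
  have hrabs := abs_lt.mp hr
  have hsabs := abs_lt.mp hs
  -- ψ = 1 - ρ t > 0
  have hρm : |ρ| < m := by rw [hρdef, abs_lt]; constructor <;> linarith
  have ht : |t| ≤ |ρ| := Literature.Barriers.HubbardSuperconductivity.abs_tanh_le_abs_self ρ
  have hψpos : 0 < 1 - ρ * t := by
    have h1 : ρ * t ≤ |ρ| * |t| := by rw [← abs_mul]; exact le_abs_self _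
    have h2 : |ρ| * |t| ≤ |ρ| * |ρ| := mul_le_mul_of_nonneg_left ht (abs_nonneg _)
    have h3 : |ρ| * |ρ| < m * m := mul_self_lt_mul_self (abs_nonneg _) hρm
    nlinarith
  have hid := two_psi_sq_mul t ρ (Real.artanh (r / m)) (Real.artanh (s / m)) (1 / m / (1 - (r / m) ^ 2))
    (m / 2 * ((1 + r / m) * Real.log (1 + r / m) + (1 - r / m) * Real.log (1 - r / m)))
    (m / 2 * ((1 + s / m) * Real.log (1 + s / m) + (1 - s / m) * Real.log (1 - s / m))) hψpos.ne'
  have hψ2 : 0 < 2 * (1 - ρ * t) ^ 2 := by positivity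
  -- 2ψ² Z₁ = E ≥ floor > 0
  have hE : 0 < 2 * (1 - ρ * t) ^ 2 *
      (((1 / m / (1 - (r / m) ^ 2) -
            ((1 - t ^ 2) * (1 / 2) *
                (m / 2 * ((1 + r / m) * Real.log (1 + r / m) + (1 - r / m) * Real.log (1 - r / m)) +
                  m / 2 * ((1 + s / m) * Real.log (1 + s / m) + (1 - s / m) * Real.log (1 - s / m))) +
              t * Real.artanh (r / m))) * (1 - ρ * t) -
        (Real.artanh (r / m) - Real.artanh (s / m) -
            t * (m / 2 * ((1 + r / m) * Real.log (1 + r / m) + (1 - r / m) * Real.log (1 - r / m)) +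
                m / 2 * ((1 + s / m) * Real.log (1 + s / m) + (1 - s / m) * Real.log (1 - s / m)))) *
          (-(t + ρ * (1 - t ^ 2)) * (1 / 2))) / (1 - ρ * t) ^ 2) := by
    rw [hid]
    linarith
  exact pos_of_mul_pos_right hE hψ2.le

end Summit.NavierStokesRegularity.NavierStokesRegularity.Theorems.PoloidalWindowDoorPoloidalWindowRigidityZShockHodographHump
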